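import Summits.HodgeConjecture.HodgeConjecture.Theorems.R90S10M3InputLettersDefs      -- ★ p863649 (typ4): `PSLocalCharTransferLetter` (letter (3)) and its currency (`HLoc`, `Gqs`, `H1Loc`, `MatchE1`, `cmPrincipalSeriesH`)
import Literature.NumberTheory.Automorphic.UnitaryGroupConstantTermSplit               -- ★ `UnitaryGroup.cmSplitTransfer` (the NAMED split transfer `f ↦ τ_w · f̄^P`)
import Literature.NumberTheory.Automorphic.OrbitalMeasureCanonical                     -- ★ `OrbitalMeasureFamily.IsCanonical`
import HarnessLib

/-!
# R90 · S10 — the two SPLIT-PLACE INPUT LETTERS behind letter (3) `PSLocalCharTransferLetter` at a place `w` of `L⁺` SPLIT in `L`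
# (RULING J-M3-4: (M-a) `SplitHVanDijkLetter`, (M-b) `SplitInductionInStagesLetter`; the dealt (M-c) is DISCHARGED by the reduction; DEFS, 0 sorry)

Cell `hodgecm-mathlib`, crux H413 (`stmt-HodgeConjecture-24833`), route of record `HCCMUnconditional`; slab R90-TF, section S10 = §13.8; seat R90-C138-p06 (g0),
DEAL #14 (J-M3-3 (iii)) + RULING J-M3-4 (R90-C138-plan (g2), 2026-09-05T00:52:32Z: «GO (i), HYPOTHESIS-FIRST, TWO files by p06's own pen»).  Definition lane
(`--kind definition --supports stmt-HodgeConjecture-24833 --as helper`); statement layer only — two CLOSED `def … : Prop` + their `Iff.rfl` read-backs; no instance,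
no notation, no axiom, no `sorry`; ★-only imports (law L9).  Binder currency = typ4's ★ p863649 (`{_msH} {_msG} [BorelSpace]² {_qH} {_qQ} KG KHw νQw νHw [IsHaarMeasure]²
mHw mQw`) + RULING J-M3-1∕J-M3-3 (`[IsMulRightInvariant]`, Borel quotient σ-algebras, canonicity) where the letter needs them.

THE MATHEMATICS [Rogawski1990 §4.13 Lemma 4.13.1 (a)(b) pp. 64–66; §4.9 Prop. 4.9.1, Lemma 4.9.2 pp. 55–56; §12.1 p. 171; §13.8 p. 217 «if `v` splits in `E` … (∗) holds»].
At a place `w` of `L⁺` SPLIT in `L` (`∃ W ∣ w, c • W ≠ W`): `G_w = U(Φ₃)(L⁺_w) ≅ GL₃(L_W)`, `H_w = U(Φ₂)_w × U(Φ₁)_w ≅ GL₂(L_W) × GL₁(L_W)` is a LEVI subgroup, the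
endoscopic transfer is the NAMED map `φ ↦ τ_w · φ̄^P` (★ `UnitaryGroup.cmSplitTransfer`, a `Δ‴_w`-transfer for canonical families ★ `isLocalDeltaTransfer_cmSplitTransfer`),
and Lemma 4.9.2 («`Tr i_G(χ̃)(φ) = Tr i_H(χ)(φ^H)`») is parabolic descent: van Dijk's formula on both sides + induction in stages `Borel ⊂ P_(2,1) ⊂ GL₃`.  Letter (3) asks
it for an ARBITRARY `Δ‴_w`-matched pair `(f^H, φ)` (C2's `MatchE1`), with the principal series `I ≅ i_G(χ̃)` IDENTIFIED and `K_w`-UNRAMIFIED.  The inputs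
missing in the tree (p06's census `R90/R90-C138-p06/g0/CENSUS-D14-PSLocalCharTransferSplit.md` 0420e1d1c70c856a, verdict (c) accepted by J-M3-4) are, as CLOSED letters:
* §1 (M-a) **`SplitHVanDijkLetter L μ w νHw mHw mQw`** — the `H`-SIDE VAN DIJK ∕ WEYL FACT at a split place: for a canonical `mHw`, the character of (a realisation of)
  `i_H(χ₂ ⊠ χ₁)` takes THE SAME VALUE on any two test functions `f^H, f′^H` that are `Δ‴_w`-transfers of the SAME `φ` (their `G`-regular stable orbital integrals
  agree, and the character of an induced representation of `GL₂ × GL₁` is a locally integrable class function supported by the regular set [vanDijk1972; Rogawski1990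
  §4.13 (b), §12.1]).  This is what lets ANY matched pair replace the named transfer.
* §2 (M-b) **`SplitInductionInStagesLetter L μ w νQw νHw`** — LEMMA 4.13.1 (b) + INDUCTION IN STAGES FOR THE NAMED TRANSFER, WITH THE PRINCIPAL SERIES IDENTIFIED: for
  every inducing pair `(χ₂, χ₁)` (`χ₁` smooth) and every realisation `ρ_w ≅ i_H(χ₂ ⊠ χ₁)` there are `χ̃` and an ADMISSIBLE realisation `I ≅ i_G(χ̃) = cmPrincipalSeries L 3 w χ̃`
  on `Gqs L w` with `Tr I(φ) = Tr ρ_w(τ_w·φ̄^P)` for every test `φ` (payer's road: ★ S3 J1 `splitSigmaDictionary_GL3` + ★ VD `GLn.vanDijkTraceParabolicIndGL_admissible` + ★ J2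
  `splitTransport_parabolicIndGL3` + the stages isomorphism `Ind_B^{GL₃} = Ind_{P_(2,1)}^{GL₃} ∘ Ind_{B∩M}^{M}` transported along ★ `localSplitEquiv`).
* (M-c) of the census — the `K`-LINE `dim I^{K_w} = 1` — is NOT a letter: the reduction DISCHARGES it from (M-a) + the tree's split unit fundamental lemma BY
  NAME (★ `isLocalUnitTransfer_finExplicitCollection_of_split`: `1_{K_H}` is a `Δ‴_w`-transfer of `1_{K}` at a split unramified hyperspecial place with unit volumes
  [Prop. 4.9.1 (b)]) + ★ `Representation.smoothTrace_indicator` (`Tr π(1_K) = vol(K)·dim π^K`) + ★ `isAdmissible_cmPrincipalSeriesH`: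
  `vol(K)·dim I^K = Tr I(1_K) = Tr ρ_w(τ_w·1̄_K^P) = Tr ρ_w(1_{K_H}) = vol(K_H)·dim ρ_w^{K_H} = 1`.
The sorry-free reduction `localCharTransfer_cmPrincipalSeries_of_split : (M-a) → (M-b) → ‹J-M3-3 binders› → PSLocalCharTransferLetter …` is the payer file
`Theorems/R90S10PSLocalCharTransferSplit.lean` (this seat).  (M-a), (M-b) are GL-side ∕ S3 payers (named here so S3's desk can claim them); S10 carries them as hypotheses.
HONEST LABEL: letters pay nothing; HC_CM is proved only modulo the 7 printed citations (2 remaining named inputs: hLiu418 = stmt-HodgeConjecture-24832, h413 =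
stmt-HodgeConjecture-24833) until rung 0 closes; REL ≠ ★ ≠ BUILT.

## References
* [Rogawski1990] J. D. Rogawski, *Automorphic Representations of Unitary Groups in Three Variables*, Ann. of Math. Stud. 123 (1990): §4.13 Lemma 4.13.1 (a)(b)
  pp. 64–66; §4.9 Prop. 4.9.1 (a)(b) p. 55, Lemma 4.9.2 pp. 55–56; §12.1 p. 171; §13.8 p. 217, p. 218 L9 (ii), p. 219 L3.
* [vanDijk1972] G. van Dijk, *Computation of certain induced characters of 𝔭-adic groups*, Math. Ann. 199 (1972), Thm. p. 237.
* [BernsteinZelevinsky1977] I. N. Bernstein, A. V. Zelevinsky, *Induced representations of reductive 𝔭-adic groups I*, Ann. Sci. ÉNS 10 (1977), §2.3 (induction in stages).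
* [GetzHahn2024] J. Getz, H. Hahn, *An Introduction to Automorphic Representations*, GTM 300 (2024), §8.5 (8.15) p. 159.
-/

set_option autoImplicit false
-- the mandated namespace repeats the single-problem summit's segment (`HodgeConjecture.HodgeConjecture`)
set_option linter.dupNamespace false

noncomputable section

open scoped Matrix MatrixGroups
open MeasureTheory NumberField IsDedekindDomain
open Literature.NumberTheory.Rogawski1990 Literature.NumberTheory.Automorphic Literature.NumberTheory.Automorphic.UnitaryGroup
open Literature.NumberTheory.GaloisRepresentations
open Summit.HodgeConjecture.HodgeConjecture.Cruxes.H413.K2E1TraceFormulaBeta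

namespace Summit.HodgeConjecture.HodgeConjecture.R90.S10

/-! ## §1 (M-a) the `H`-side van Dijk ∕ Weyl fact at a split place -/

/-- **(M-a) `SplitHVanDijkLetter L μ w νHw mHw mQw`** — at a place `w` of `L⁺` SPLIT in `L`, for `mHw` CANONICAL w.r.t. the Haar measure `νHw` on the `G`-regular
classes: for every inducing pair `(χ₂, χ₁)` (`χ₁` smooth), every realisation `ρ_w ≅ i_H(χ₂ ⊠ χ₁)` (★ `cmPrincipalSeriesH`), and every two C2-matched pairs
`(f^H, φ)`, `(f′^H, φ)` with the SAME `φ` (★ `MatchE1`: smooth + `Δ‴_w`-transfer at the factor of record), `Tr ρ_w(f^H) = Tr ρ_w(f′^H)`.  WHY TRUE: both `f^H` and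
`f′^H` have the stable orbital integrals `Σ_{[γ]} Δ‴_w(γ_H, γ) Φ([γ], φ)` at every `G`-regular `γ_H` (`IsLocalDeltaTransfer`), stable = ordinary conjugacy on
`H_w ≅ GL₂ × GL₁(L_W)`, the `G`-regular set is conull, and the character of a principal series of `GL₂ × GL₁` is a locally integrable class function [van Dijk], so the
Weyl integration formula expresses `Tr ρ_w(f^H)` through those orbital integrals (canonical measures).  Why it might fail: only if `mHw` vanished on some regular
class — excluded by canonicity. [cite: vanDijk1972, Thm. p. 237] [cite: Rogawski1990, §4.13 Lemma 4.13.1 (b) p. 64; §12.1 p. 171; §4.3 (4.3.1) p. 43] -/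
def SplitHVanDijkLetter (L : Type) [Field L] [NumberField L] [IsCMField L] (μ : HeckeCharacter L) (w : Pl L)
    {_msH : MeasurableSpace (HLoc L w)} [BorelSpace (HLoc L w)]
    {_qH : ∀ a : HLoc L w, MeasurableSpace (HLoc L w ⧸ Subgroup.centralizer ({a} : Set (HLoc L w)))}
    [∀ a : HLoc L w, BorelSpace (HLoc L w ⧸ Subgroup.centralizer ({a} : Set (HLoc L w)))]
    {_qQ : ∀ γ : Gqs L w, MeasurableSpace (Gqs L w ⧸ Subgroup.centralizer ({γ} : Set (Gqs L w)))}
    (νHw : Measure (HLoc L w)) [νHw.IsHaarMeasure] [νHw.IsMulRightInvariant]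
    (mHw : OrbitalMeasureFamily (HLoc L w)) (mQw : OrbitalMeasureFamily (Gqs L w)) : Prop :=
  (∃ W : PlacesOver L w, IsCMField.complexConj L • W.1 ≠ W.1) →
    mHw.IsCanonical (IsLocalGRegular L w) νHw →
    ∀ (χ₂ : ↥(torusU (conjLocal L (IsCMField.complexConj L) w) (cmLocalForm L 2 w)) →* ℂˣ) (χ₁ : H1Loc L w →* ℂˣ),
      IsOpen ((χ₁.ker : Subgroup (H1Loc L w)) : Set (H1Loc L w)) →
      ∀ ⦃Vw : Type⦄ [AddCommGroup Vw] [Module ℂ Vw] (ρw : Representation ℂ (HLoc L w) Vw),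
        Nonempty (ρw.Equiv (cmPrincipalSeriesH L w χ₂ χ₁)) →
        ∀ (fH fH' : HLoc L w → ℂ) (φ : Gqs L w → ℂ), MatchE1 L μ w mHw mQw fH φ → MatchE1 L μ w mHw mQw fH' φ →
          ρw.smoothTrace νHw fH = ρw.smoothTrace νHw fH'

/-- Read-back, `Iff.rfl`. [cite: vanDijk1972, Thm. p. 237] -/
theorem splitHVanDijkLetter_iff (L : Type) [Field L] [NumberField L] [IsCMField L] (μ : HeckeCharacter L) (w : Pl L)
    {_msH : MeasurableSpace (HLoc L w)} [BorelSpace (HLoc L w)]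
    {_qH : ∀ a : HLoc L w, MeasurableSpace (HLoc L w ⧸ Subgroup.centralizer ({a} : Set (HLoc L w)))}
    [∀ a : HLoc L w, BorelSpace (HLoc L w ⧸ Subgroup.centralizer ({a} : Set (HLoc L w)))]
    {_qQ : ∀ γ : Gqs L w, MeasurableSpace (Gqs L w ⧸ Subgroup.centralizer ({γ} : Set (Gqs L w)))}
    (νHw : Measure (HLoc L w)) [νHw.IsHaarMeasure] [νHw.IsMulRightInvariant]
    (mHw : OrbitalMeasureFamily (HLoc L w)) (mQw : OrbitalMeasureFamily (Gqs L w)) :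
    SplitHVanDijkLetter L μ w νHw mHw mQw ↔
      ((∃ W : PlacesOver L w, IsCMField.complexConj L • W.1 ≠ W.1) →
        mHw.IsCanonical (IsLocalGRegular L w) νHw →
        ∀ (χ₂ : ↥(torusU (conjLocal L (IsCMField.complexConj L) w) (cmLocalForm L 2 w)) →* ℂˣ) (χ₁ : H1Loc L w →* ℂˣ),
          IsOpen ((χ₁.ker : Subgroup (H1Loc L w)) : Set (H1Loc L w)) →
          ∀ ⦃Vw : Type⦄ [AddCommGroup Vw] [Module ℂ Vw] (ρw : Representation ℂ (HLoc L w) Vw),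
            Nonempty (ρw.Equiv (cmPrincipalSeriesH L w χ₂ χ₁)) →
            ∀ (fH fH' : HLoc L w → ℂ) (φ : Gqs L w → ℂ), MatchE1 L μ w mHw mQw fH φ → MatchE1 L μ w mHw mQw fH' φ →
              ρw.smoothTrace νHw fH = ρw.smoothTrace νHw fH') :=
  Iff.rfl

/-! ## §2 (M-b) Lemma 4.13.1 (b) + induction in stages for the NAMED split transfer, with the principal series identified -/

/-- **(M-b) `SplitInductionInStagesLetter L μ w νQw νHw`** — at every place `W ∣ w` with `c • W ≠ W` (so `w` splits): for every inducing pair `(χ₂, χ₁)` (`χ₁` smooth) and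
every realisation `ρ_w ≅ i_H(χ₂ ⊠ χ₁)` there are a character `χ̃` of the diagonal torus of `U(Φ₃)(L⁺_w)` and an ADMISSIBLE realisation `I ≅ i_G(χ̃) = cmPrincipalSeries L 3 w χ̃` on
`Gqs L w` such that for every test `φ` on `G_w`, `Tr I(φ) = Tr ρ_w(τ_w · φ̄^P)` with `τ_w · φ̄^P` = ★ `UnitaryGroup.cmSplitTransfer L Φ₃ _ _ w W hW μ νHw νQw φ` (the NAMED
transfer of §4.13).  WHY TRUE: print's Lemma 4.9.2 at a split place is parabolic descent — `Tr Ind_{P_(2,1)}^{GL₃}(σ̃)(φ) = Tr σ̃(φ̄^P)` [L. 4.13.1 (b), van Dijk] for the block-Levi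
datum `σ̃` of `ρ_w ⊗ (μ_W ∘ det ∘ e₂)` (★ J1 `R90.S3.splitSigmaDictionary_GL3` + ★ `GLn.vanDijkTraceParabolicIndGL_admissible` + ★ J2 `splitTransport_parabolicIndGL3`), and induction
in stages `Ind_{P_(2,1)}(i_{GL₂×GL₁}(χ₂′ ⊠ χ₁′)) ≅ i_{GL₃}(χ̃)` transported back to `Gqs L w` along ★ `localSplitEquiv`; `χ̃ = χ·μ̃` (print, `T_H = T`).  Why it might fail: a
normalisation constant in ★ `cmSplitTransfer` (`νQw(K′)∕νHw(K_M)`) — print's constant is `1` for matching measures; the letter binds ARBITRARY Haar measures, and the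
payer's van Dijk chain carries exactly this constant on both sides. [cite: Rogawski1990, §4.13 Lemma 4.13.1 (b) pp. 64–66; §4.9 Lemma 4.9.2 pp. 55–56; §12.1 p. 171]
[cite: vanDijk1972, Thm. p. 237] [cite: BernsteinZelevinsky1977, §2.3] -/
def SplitInductionInStagesLetter (L : Type) [Field L] [NumberField L] [IsCMField L] (μ : HeckeCharacter L) (w : Pl L)
    {_msH : MeasurableSpace (HLoc L w)} {_msG : MeasurableSpace (Gqs L w)} [BorelSpace (HLoc L w)] [BorelSpace (Gqs L w)]
    (νQw : Measure (Gqs L w)) (νHw : Measure (HLoc L w)) [νQw.IsHaarMeasure] [νHw.IsHaarMeasure] : Prop :=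
  ∀ (W : PlacesOver L w) (hW : IsCMField.complexConj L • W.1 ≠ W.1)
    (χ₂ : ↥(torusU (conjLocal L (IsCMField.complexConj L) w) (cmLocalForm L 2 w)) →* ℂˣ) (χ₁ : H1Loc L w →* ℂˣ),
    IsOpen ((χ₁.ker : Subgroup (H1Loc L w)) : Set (H1Loc L w)) →
    ∀ ⦃Vw : Type⦄ [AddCommGroup Vw] [Module ℂ Vw] (ρw : Representation ℂ (HLoc L w) Vw),
      Nonempty (ρw.Equiv (cmPrincipalSeriesH L w χ₂ χ₁)) →
      ∃ (χt : ↥(torusU (conjLocal L (IsCMField.complexConj L) w) (cmLocalForm L 3 w)) →* ℂˣ)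
        (Wsp : Type) (_ : AddCommGroup Wsp) (_ : Module ℂ Wsp) (I : Representation ℂ (Gqs L w) Wsp),
        Nonempty (I.Equiv (cmPrincipalSeries L 3 w χt)) ∧ I.IsAdmissible ∧
          ∀ φ : Gqs L w → ℂ, IsLocSmooth φ →
            I.smoothTrace νQw φ =
              ρw.smoothTrace νHw (UnitaryGroup.cmSplitTransfer L (qsForm L) (antidiagOne_isHermitian L 3) (isUnit_antidiagOne_det L 3) w W hW μ νHw νQw φ)

/-- Read-back, `Iff.rfl`. [cite: Rogawski1990, §4.13 Lemma 4.13.1 (b) p. 64] -/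
theorem splitInductionInStagesLetter_iff (L : Type) [Field L] [NumberField L] [IsCMField L] (μ : HeckeCharacter L) (w : Pl L)
    {_msH : MeasurableSpace (HLoc L w)} {_msG : MeasurableSpace (Gqs L w)} [BorelSpace (HLoc L w)] [BorelSpace (Gqs L w)]
    (νQw : Measure (Gqs L w)) (νHw : Measure (HLoc L w)) [νQw.IsHaarMeasure] [νHw.IsHaarMeasure] :
    SplitInductionInStagesLetter L μ w νQw νHw ↔
      ∀ (W : PlacesOver L w) (hW : IsCMField.complexConj L • W.1 ≠ W.1)
        (χ₂ : ↥(torusU (conjLocal L (IsCMField.complexConj L) w) (cmLocalForm L 2 w)) →* ℂˣ) (χ₁ : H1Loc L w →* ℂˣ),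
        IsOpen ((χ₁.ker : Subgroup (H1Loc L w)) : Set (H1Loc L w)) →
        ∀ ⦃Vw : Type⦄ [AddCommGroup Vw] [Module ℂ Vw] (ρw : Representation ℂ (HLoc L w) Vw),
          Nonempty (ρw.Equiv (cmPrincipalSeriesH L w χ₂ χ₁)) →
          ∃ (χt : ↥(torusU (conjLocal L (IsCMField.complexConj L) w) (cmLocalForm L 3 w)) →* ℂˣ)
            (Wsp : Type) (_ : AddCommGroup Wsp) (_ : Module ℂ Wsp) (I : Representation ℂ (Gqs L w) Wsp),
            Nonempty (I.Equiv (cmPrincipalSeries L 3 w χt)) ∧ I.IsAdmissible ∧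
              ∀ φ : Gqs L w → ℂ, IsLocSmooth φ →
                I.smoothTrace νQw φ =
                  ρw.smoothTrace νHw (UnitaryGroup.cmSplitTransfer L (qsForm L) (antidiagOne_isHermitian L 3) (isUnit_antidiagOne_det L 3) w W hW μ νHw νQw φ) :=
  Iff.rfl

end Summit.HodgeConjecture.HodgeConjecture.R90.S10

end
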